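import Literature.AlgebraicTopology.FundamentalGroup.CircleValuedCollapse
import Literature.AlgebraicTopology.FundamentalGroup.CircleValuedWindingCrossing
import HarnessLib

/-!
# The dual loop: a crossing arc closed up by a path avoiding the hypersurface

Topic `Literature/AlgebraicTopology/FundamentalGroup`; a proved complement to
`CircleValuedWindingCrossing.lean` (a loop meeting the fibre `θ⁻¹(0)` of a circle-valued map
`θ : Y → ℝ/ℤ` at a single time, with a sign-changing local real lift, has winding number `±1`:
`windingHom_ne_one_of_crossing`) and `CircleValuedCollapse.lean` (the collapse
`circleCollapse K ρ` of a normal coordinate).  **Everything here is proved; no definitions, no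
named facts.**

It supplies the LOOP demanded by `windingHom_ne_one_of_crossing` in the form in which geometry
produces it (Hatcher, *Algebraic Topology* (2002), Example 1.23 / proof of Thm. 1.7; Rolfsen,
*Knots and Links*, 5.D: "a closed curve meeting the two-sided surface in one point, transversally,
is essential"): a short **crossing arc** `α` from `a` to `b` along which `θ` has a real lift `Λ`
of absolute value `≤ 1/2`, vanishing at one interior time `s₀`, negative before and positive
after, closed up by a **return path** `β` from `b` to `a` which avoids the fibre `θ⁻¹(0)`.  The
concatenation `γ = α · β` is a loop at `a` meeting `θ⁻¹(0)` only at the time `s₀ / 2`, with the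
local lift `t ↦ Λ (2t)`:

* `exists_crossing_data_trans` — the hypotheses of `windingHom_ne_one_of_crossing` for
  `γ = α.trans β`;
* `windingHom_ne_one_of_arc_of_path` — hence the winding homomorphism of `θ` is non-trivial and
  `[α · β] ≠ 1` in `π₁(Y, a)` (`wind_trans_eq_ofAdd_one_of_arc_of_path`: the winding number of
  `α · β` is exactly `+1`);
* `windingHom_circleCollapse_ne_one_of_arc_of_path` — the same for the collapse
  `θ = circleCollapse K ρ` of a normal coordinate: an arc inside the region where the cut-off is
  `1`, along which `K` vanishes once and changes sign from `-` to `+`, and a return path missing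
  the hypersurface `P = {K = 0}`.

In the application (`Literature/Topology/FourManifolds/TrisectionFunctorGKPi1Obstruction.lean`)
`Y` is the central surface of a trisection, `P` a non-separating reducing curve `δ`, `α` a short
arc across `δ` and `β` a path in the connected `Y ∖ δ`.

## References

* A. Hatcher, *Algebraic Topology*, CUP (2002), Thm. 1.7 (p. 29) and its proof, Prop. 1.30.
  [HatcherAT2002]
* D. Rolfsen, *Knots and Links*, Publish or Perish (1976), §5.D.
-/

noncomputable section

open scoped unitInterval Topology
open Set Function Filter

namespace Literature.AlgebraicTopology.FundamentalGroup

variable {Y : Type*} [TopologicalSpace Y]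

/-! ### Times on the concatenation -/

/-- On the first half, `α.trans β` runs through `α` at double speed. [folklore] -/
theorem trans_apply_left {a b c : Y} (α : Path a b) (β : Path b c) {t : I} (ht : (t : ℝ) ≤ 1 / 2) :
    (α.trans β) t = α ⟨2 * t, (unitInterval.mul_pos_mem_iff zero_lt_two).2 ⟨t.2.1, ht⟩⟩ := by
  rw [Path.trans_apply, dif_pos ht]

/-- On the second half, `α.trans β` runs through `β` at double speed. [folklore] -/
theorem trans_apply_right {a b c : Y} (α : Path a b) (β : Path b c) {t : I}
    (ht : ¬ (t : ℝ) ≤ 1 / 2) :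
    (α.trans β) t = β ⟨2 * t - 1,
      unitInterval.two_mul_sub_one_mem_iff.2 ⟨(not_le.1 ht).le, t.2.2⟩⟩ := by
  rw [Path.trans_apply, dif_neg ht]

/-! ### The crossing data of `α · β` -/

/-- **The concatenation of a crossing arc and a return path satisfies the hypotheses of
`windingHom_ne_one_of_crossing`.**  Let `θ : Y → ℝ/ℤ` be continuous, `α` a path from `a` to `b`
with a continuous real lift `Λ` of `θ ∘ α` (`|Λ| ≤ 1/2`) which vanishes at the time `s₀`, is
negative before `s₀` and positive after `s₀`, and `β` a path from `b` back to `a` along which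
`θ ≠ 0`.  Then the loop `γ = α.trans β` meets `θ⁻¹(0)` only at `t₀ = s₀ / 2`, and on the open
set `U = {t < 1/2}` ∋ `t₀` the function `μ t = Λ (2t)` is a continuous real lift of `θ ∘ γ`
with `μ t₀ = 0`, `μ > 0` after `t₀`, `μ < 0` before `t₀`.
[cite: HatcherAT2002, Thm. 1.7 (p. 29) and its proof] -/
theorem exists_crossing_data_trans (θ : C(Y, AddCircle (1 : ℝ))) {a b : Y} (α : Path a b)
    (β : Path b a) {Λ : I → ℝ} (hΛc : Continuous Λ)
    (hΛlift : ∀ s, ((Λ s : ℝ) : AddCircle (1 : ℝ)) = θ (α s)) (hΛabs : ∀ s, |Λ s| ≤ 2⁻¹)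
    (s₀ : I) (hΛ0 : Λ s₀ = 0) (hneg : ∀ s, s < s₀ → Λ s < 0) (hpos : ∀ s, s₀ < s → 0 < Λ s)
    (hβ : ∀ s, θ (β s) ≠ 0) :
    ∃ (t₀ : I) (U : Set I) (μ : I → ℝ), (t₀ : ℝ) = s₀ / 2 ∧
      (∀ t, θ ((α.trans β) t) = 0 → t = t₀) ∧ U ∈ 𝓝 t₀ ∧ ContinuousOn μ U ∧
      (∀ t ∈ U, ((μ t : ℝ) : AddCircle (1 : ℝ)) = θ ((α.trans β) t)) ∧ μ t₀ = 0 ∧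
      (∀ t ∈ U, t₀ < t → 0 < μ t) ∧ (∀ t ∈ U, t < t₀ → μ t < 0) := by
  -- `Λ` vanishes only at `s₀`
  have hΛne : ∀ s, s ≠ s₀ → Λ s ≠ 0 := fun s hs => by
    rcases lt_or_gt_of_ne hs with h | h
    · exact (hneg s h).ne
    · exact (hpos s h).ne'
  -- `s₀ < 1`: the end `b = α 1 = β 0` is off the fibre
  have hs₀1 : (s₀ : ℝ) < 1 := by
    rcases eq_or_lt_of_le s₀.2.2 with h | h
    · exfalso
      apply hβ 0
      rw [β.source, ← α.target, ← hΛlift 1]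
      have : (1 : I) = s₀ := Subtype.ext h.symm
      rw [this, hΛ0, QuotientAddGroup.mk_zero]
    · exact h
  set t₀ : I := ⟨(s₀ : ℝ) / 2, by linarith [s₀.2.1], by linarith [s₀.2.2]⟩ with ht₀
  have ht₀le : (t₀ : ℝ) ≤ 1 / 2 := by
    show (s₀ : ℝ) / 2 ≤ 1 / 2
    linarith [s₀.2.2]
  set U : Set I := {t | (t : ℝ) < 1 / 2} with hU
  have hUo : IsOpen U := isOpen_lt continuous_subtype_val continuous_const
  have ht₀U : t₀ ∈ U := by
    show (s₀ : ℝ) / 2 < 1 / 2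
    linarith
  set μ : I → ℝ := fun t => Λ (projIcc 0 1 zero_le_one (2 * t)) with hμ
  -- the double time of a point of the first half, as a point of `[0, 1]`
  have hproj : ∀ t : I, ∀ ht : (t : ℝ) ≤ 1 / 2, projIcc 0 1 zero_le_one (2 * (t : ℝ)) =
      ⟨2 * t, (unitInterval.mul_pos_mem_iff zero_lt_two).2 ⟨t.2.1, ht⟩⟩ := fun t ht =>
    projIcc_of_mem _ ((unitInterval.mul_pos_mem_iff zero_lt_two).2 ⟨t.2.1, ht⟩)
  refine ⟨t₀, U, μ, rfl, fun t ht => ?_, hUo.mem_nhds ht₀U, ?_, fun t htU => ?_, ?_,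
    fun t htU hlt => ?_, fun t htU hlt => ?_⟩
  · -- the fibre is met only at `t₀`
    by_cases hle : (t : ℝ) ≤ 1 / 2
    · rw [trans_apply_left α β hle, ← hΛlift] at ht
      have hz := (coe_eq_zero_iff_of_abs_le (hΛabs _)).1 ht
      have hs : (⟨2 * t, (unitInterval.mul_pos_mem_iff zero_lt_two).2 ⟨t.2.1, hle⟩⟩ : I) = s₀ := by
        by_contra hne
        exact hΛne _ hne hz
      apply Subtype.ext
      have h2 : 2 * (t : ℝ) = s₀ := congrArg Subtype.val hs
      show (t : ℝ) = s₀ / 2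
      linarith
    · exfalso
      rw [trans_apply_right α β hle] at ht
      exact hβ _ ht
  · exact (hΛc.comp (continuous_projIcc.comp (continuous_const.mul continuous_subtype_val))).continuousOn
  · -- `μ` lifts `θ ∘ γ` on the first half
    have hle : (t : ℝ) ≤ 1 / 2 := le_of_lt htU
    simp only [hμ]
    rw [hproj t hle, hΛlift, trans_apply_left α β hle]
  · -- `μ t₀ = Λ s₀ = 0`
    simp only [hμ]
    rw [hproj t₀ ht₀le]
    have : (⟨2 * t₀, (unitInterval.mul_pos_mem_iff zero_lt_two).2 ⟨t₀.2.1, ht₀le⟩⟩ : I) = s₀ := by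
      apply Subtype.ext
      show 2 * ((s₀ : ℝ) / 2) = s₀
      ring
    rw [this, hΛ0]
  · -- after `t₀` (inside `U`): `2t > s₀`
    have hle : (t : ℝ) ≤ 1 / 2 := le_of_lt htU
    simp only [hμ]
    rw [hproj t hle]
    refine hpos _ ?_
    change (s₀ : ℝ) < 2 * t
    have : (s₀ : ℝ) / 2 < t := hlt
    linarith
  · -- before `t₀`: `2t < s₀`
    have hle : (t : ℝ) ≤ 1 / 2 := le_of_lt htU
    simp only [hμ]
    rw [hproj t hle]
    refine hneg _ ?_
    change 2 * (t : ℝ) < s₀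
    have : (t : ℝ) < s₀ / 2 := hlt
    linarith

/-- **A crossing arc closed up by a path avoiding the fibre gives a loop of winding number `+1`**,
so the winding homomorphism of `θ` at `a` is non-trivial and `[α · β] ≠ 1` in `π₁(Y, a)`.
[cite: HatcherAT2002, Thm. 1.7 (p. 29) and its proof] -/
theorem windingHom_ne_one_of_arc_of_path (θ : C(Y, AddCircle (1 : ℝ))) {a b : Y} (α : Path a b)
    (β : Path b a) {Λ : I → ℝ} (hΛc : Continuous Λ)
    (hΛlift : ∀ s, ((Λ s : ℝ) : AddCircle (1 : ℝ)) = θ (α s)) (hΛabs : ∀ s, |Λ s| ≤ 2⁻¹)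
    (s₀ : I) (hΛ0 : Λ s₀ = 0) (hneg : ∀ s, s < s₀ → Λ s < 0) (hpos : ∀ s, s₀ < s → 0 < Λ s)
    (hβ : ∀ s, θ (β s) ≠ 0) :
    ((fundamentalGroupAddCircleEquiv one_ne_zero (θ a)).toMonoidHom.comp
        (_root_.FundamentalGroup.map θ a) ≠ 1) ∧
      _root_.FundamentalGroup.fromPath (Path.Homotopic.Quotient.mk (α.trans β)) ≠
        (1 : FundamentalGroup Y a) := by
  obtain ⟨t₀, U, μ, -, honly, hU, hμ, hμlift, hμ0, hpos', hneg'⟩ :=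
    exists_crossing_data_trans θ α β hΛc hΛlift hΛabs s₀ hΛ0 hneg hpos hβ
  exact windingHom_ne_one_of_crossing θ (α.trans β) t₀ honly hU hμ hμlift hμ0
    (Or.inl ⟨hpos', hneg'⟩)

/-- The winding number of `α · β` is exactly `+1`. [cite: HatcherAT2002, Thm. 1.7 (p. 29) and its proof] -/
theorem wind_trans_eq_ofAdd_one_of_arc_of_path (θ : C(Y, AddCircle (1 : ℝ))) {a b : Y}
    (α : Path a b) (β : Path b a) {Λ : I → ℝ} (hΛc : Continuous Λ)
    (hΛlift : ∀ s, ((Λ s : ℝ) : AddCircle (1 : ℝ)) = θ (α s)) (hΛabs : ∀ s, |Λ s| ≤ 2⁻¹)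
    (s₀ : I) (hΛ0 : Λ s₀ = 0) (hneg : ∀ s, s < s₀ → Λ s < 0) (hpos : ∀ s, s₀ < s → 0 < Λ s)
    (hβ : ∀ s, θ (β s) ≠ 0) :
    fundamentalGroupAddCircleEquiv one_ne_zero (θ a)
        (_root_.FundamentalGroup.map θ a
          (_root_.FundamentalGroup.fromPath (Path.Homotopic.Quotient.mk (α.trans β)))) =
      Multiplicative.ofAdd (1 : ℤ) := by
  obtain ⟨t₀, U, μ, -, honly, hU, hμ, hμlift, hμ0, hpos', hneg'⟩ :=
    exists_crossing_data_trans θ α β hΛc hΛlift hΛabs s₀ hΛ0 hneg hpos hβ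
  exact wind_eq_ofAdd_one_of_crossing θ (α.trans β) t₀ honly hU hμ hμlift hμ0 hpos' hneg'

/-! ### The same for the collapse of a normal coordinate -/

/-- **The dual loop of a collapse.**  Let `θ = circleCollapse K ρ` be the collapse of a normal
coordinate `K` of `P` on the open set `N` with cut-off `ρ` (hypotheses of
`continuous_circleCollapse`, and `K = 0` on `P`).  Let `α` be a path from `a` to `b` inside a set
`V ⊆ N` on which `ρ = 1`, along which `K` vanishes at the time `s₀`, is negative before and
positive after; and let `β` be a path from `b` to `a` missing `P`.  Then the winding
homomorphism of `θ` at `a` is non-trivial and `[α · β] ≠ 1` in `π₁(Y, a)` (the local lift along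
the arc is `clampHalf ∘ K ∘ α`, `circleCollapse_eq_of_rho_eq_one`; the return path misses the
fibre `θ⁻¹(0) = P`, `circleCollapse_eq_zero_iff`).
[cite: HatcherAT2002, Thm. 1.7 (p. 29) and its proof] -/
theorem windingHom_circleCollapse_ne_one_of_arc_of_path {K ρ : Y → ℝ} {N P V : Set Y}
    (hN : IsOpen N) (hK : ContinuousOn K N) (hKne : ∀ y ∈ N, y ∉ P → K y ≠ 0)
    (hK0 : ∀ y ∈ P, K y = 0) (hρ : Continuous ρ) (hsupp : tsupport ρ ⊆ N)
    (hρP : ∀ y ∈ P, ρ y ≠ 0) (hVN : V ⊆ N) (hV1 : ∀ y ∈ V, ρ y = 1)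
    {a b : Y} (α : Path a b) (β : Path b a) (hαV : ∀ s, α s ∈ V) (s₀ : I)
    (hα0 : K (α s₀) = 0) (hαneg : ∀ s, s < s₀ → K (α s) < 0) (hαpos : ∀ s, s₀ < s → 0 < K (α s))
    (hβ : ∀ s, β s ∉ P) :
    ((fundamentalGroupAddCircleEquiv one_ne_zero (circleCollapse K ρ a)).toMonoidHom.comp
        (_root_.FundamentalGroup.map (circleCollapseMap hN hK hKne hρ hsupp hρP) a) ≠ 1) ∧
      _root_.FundamentalGroup.fromPath (Path.Homotopic.Quotient.mk (α.trans β)) ≠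
        (1 : FundamentalGroup Y a) := by
  set θ := circleCollapseMap hN hK hKne hρ hsupp hρP with hθ
  -- the lift along the arc
  set Λ : I → ℝ := fun s => clampHalf (K (α s)) with hΛ
  have hKα : Continuous fun s => K (α s) :=
    (hK.comp_continuous α.continuous fun s => hVN (hαV s))
  have hΛc : Continuous Λ := continuous_clampHalf.comp hKα
  have hΛlift : ∀ s, ((Λ s : ℝ) : AddCircle (1 : ℝ)) = θ (α s) := fun s => by
    rw [hθ, circleCollapseMap_apply, circleCollapse_eq_of_rho_eq_one (hV1 _ (hαV s))]
  have hΛabs : ∀ s, |Λ s| ≤ 2⁻¹ := fun s => abs_clampHalf_le _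
  have hΛ0 : Λ s₀ = 0 := by simp only [hΛ, hα0]; exact clampHalf_eq_zero_iff.2 rfl
  have hneg : ∀ s, s < s₀ → Λ s < 0 := fun s hs => clampHalf_neg (hαneg s hs)
  have hpos : ∀ s, s₀ < s → 0 < Λ s := fun s hs => clampHalf_pos (hαpos s hs)
  have hβ' : ∀ s, θ (β s) ≠ 0 := fun s h => by
    rw [hθ, circleCollapseMap_apply, circleCollapse_eq_zero_iff hKne hK0 hsupp hρP] at h
    exact hβ s h
  exact windingHom_ne_one_of_arc_of_path θ α β hΛc hΛlift hΛabs s₀ hΛ0 hneg hpos hβ'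

end Literature.AlgebraicTopology.FundamentalGroup

end
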